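import Summits.ResolutionOfSingularities.ResolutionOfSingularities.Theorems.MarkedTransferCampaignW46ThreefoldsGammaFreeGlobalLocal
import Summits.ResolutionOfSingularities.ResolutionOfSingularities.Theorems.MarkedTransferCampaignW46ThreefoldsGammaFreeGlobalMonomial
import Literature.AlgebraicGeometry.Resolution.DivisorialPart
import Literature.AlgebraicGeometry.Resolution.OrderSemicontinuity
import HarnessLib

/-!
# [OURS · L1 W4.6 rung (ii), dimension ladder] THE SNC END-GAME: an input whose support has simple normal crossings NEAR
# the order-`≥ m` locus is order-reducible (brick B7 of rung (ii-2); any dimension)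

Cell res-hironaka, LADDER-RESOLUTION rung L (D-0089), slot W4.6 «restricted-regime rungs of the typed Th. 16.6 procedure»,
rung (ii) (dimension ladder, res-L1-type-o1's `…GammaFreeGlobalLadder.lean` p496755); seat res-D-pv-049 AS res-L1-s46-pv-11
(holder of rung (ii-2), res-plan-2 D→L MAP v1.6 (3); plan D/res-D-pv-049/RUNG-II-2-PLAN.md, architecture v2 on STATUS
2026-08-27T05:3xZ). Host route MarkedTransfer, host item `HypersurfaceOrderReductionDimLeThree`
(stmt-ResolutionOfSingularities-16156); proposed `--kind proof --supports` it `--as helper`. Everything here is OURS scheme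
theory over the tree's blow-up library; nothing of H. Hironaka's manuscript [Hironaka2017] is asserted (Def. 2.4 p.6 / §2.1
p.4 «permissible» enter only through the campaign predicate `CampaignW46.IsPermissibleBlowupSeq`, scope only). AI-written;
AI review is weaker than expert review.

## What is proved (composition of three kernel bricks; this file adds the glue)

* `CampaignW46.comap_monomialIdeal_eq` — pull-back of a monomial ideal `Π_j K_j^{a_j}` along any morphism is the monomial
  ideal of the pulled-back list (`comap` is multiplicative).
* `CampaignW46.eq_monomialIdeal_divisorial` — **a non-zero LOCALLY PRINCIPAL ideal sheaf on a regular integral Noetherian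
  scheme IS the monomial ideal of its prime divisors with exponents the generic orders**: `I = Π_ζ 𝓘_{cl ζ}^{ord_ζ I}` over the
  finitely many codimension-one points `ζ` of `V(I)` (the tree's divisorial decomposition `divisorialPart I · codimTwoPart I = I`
  of Cossart–Piltant 2008 Prop. 4.2, with `codimTwoPart I = 𝒪_X` exactly when `I` is locally principal).
* `CampaignW46.orderReducible_monomialIdeal_of_hasSNC_nhds` — **SNC END-GAME, monomial form**: if `I = monomialIdeal E` on a
  regular locally Noetherian `X` and the boundary list restricted to an OPEN `U ⊇ Z ⊇ {ord_x I ≥ m}` (`Z` closed) has simple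
  normal crossings on `U`, then `(X, I, m)` is order-reducible for every `m ≥ 1`: on `U` by res-L1-s46-pv-3's monomial slice
  `orderReducible_monomialIdeal` (Kollár (3.111) Step 3, p499147), extended to `X` by the locality brick
  `OrderReducible.of_opens` (p500913) — points of order `< m` are never blown up and never need simple normal crossings.
* `CampaignW46.orderReducible_of_hasSNC_nhds` — **SNC END-GAME for a locally principal ideal on a regular integral
  Noetherian EXCELLENT scheme** (`Z := {ord ≥ m}` is closed by upper semicontinuity of the order,
  `isClosed_setOf_le_idealOrder`): if the prime divisors of `V(I)`, restricted to an open `U` containing every point of order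
  `≥ m`, have simple normal crossings on `U`, then `OrderReducible I m`. This is the last step of the d = 2 loop (architecture
  v2: blow up non-snc points of `Supp I` inside `Sing(I, m)` until none is left, then apply this theorem with
  `U = X ∖ NonSNC(Supp I)`), and it is dimension-free.

## Sources

* J. Kollár, *Lectures on Resolution of Singularities* (2007), (3.111) Step 3 (monomial case). [Kollar2007]
* V. Cossart, O. Piltant, J. Algebra 320 (2008), proof of Prop. 4.2 (divisorial part `H = 𝒪_X(−Σ a(i)E_i)`, `I = H·J`,
  `I` locally principal iff `J = 𝒪_X`; upper semicontinuity of the order). [CossartPiltant2008]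
* O. Piltant, RACSAM 107 (2013), proof of Prop. 5.1 Step 2 (extension from an open). [Piltant2013]
* H. Hironaka, ms. 2017-03-23, §2.1 p.4, Def. 2.1 p.5, Def. 2.4 p.6 — scope only, under adjudication, not cited as fact.
  [Hironaka2017]
-/

noncomputable section

set_option linter.dupNamespace false -- mandated namespace of this single-conjunct summit

open CategoryTheory AlgebraicGeometry TopologicalSpace IsLocalRing

namespace Summit.ResolutionOfSingularities.ResolutionOfSingularities.Theorems

namespace CampaignW46

open Literature.AlgebraicGeometry.Resolution
open Scheme.IdealSheafData
open Literature.AlgebraicGeometry.Hironaka2017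

universe u

/-! ## Monomial ideals restrict to monomial ideals -/

/-- Pull-back of a monomial ideal `Π_j K_j^{a_j}` along a morphism `f` is the monomial ideal of the pulled-back exponent list
(`comap` is multiplicative: `comap_mul`, `comap_pow`). [folklore] -/
theorem comap_monomialIdeal_eq {X Y : Scheme.{u}} (f : Y ⟶ X) (E : List (X.IdealSheafData × ℕ)) :
    (monomialIdeal E).comap f = monomialIdeal (E.map fun p => (p.1.comap f, p.2)) := by
  induction E with
  | nil => simp [monomialIdeal_nil, Scheme.IdealSheafData.comap_top]
  | cons p E ih => rw [List.map_cons, monomialIdeal_cons, monomialIdeal_cons, comap_mul, comap_pow, ih]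

/-- The boundary of the pulled-back exponent list is the list of pulled-back boundary divisors. [folklore] -/
theorem boundaryOf_map_comap {X Y : Scheme.{u}} (f : Y ⟶ X) (E : List (X.IdealSheafData × ℕ)) :
    boundaryOf (E.map fun p => (p.1.comap f, p.2)) = (boundaryOf E).map fun K => K.comap f := by
  simp [boundaryOf, List.map_map, Function.comp_def]

/-! ## A locally principal ideal is the monomial ideal of its prime divisors -/

/-- **A non-zero locally principal ideal sheaf on a regular integral Noetherian scheme is the monomial ideal of its prime
divisors**: `I = Π_{ζ} 𝓘_{cl ζ}^{ord_ζ I}` over the (finitely many) codimension-one points `ζ` of `V(I)` — the tree's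
divisorial decomposition `divisorialPart I · codimTwoPart I = I` with `codimTwoPart I = 𝒪_X` for locally principal `I`
(Cossart–Piltant 2008, proof of Prop. 4.2: «`I` is locally principal iff `J = 𝒪_X`»), re-read as a `monomialIdeal` of the
exponent list `ζ ↦ (𝓘_{cl ζ}, ord_ζ I)`. [cite: CossartPiltant2008, proof of Prop. 4.2] -/
theorem eq_monomialIdeal_divisorial {X : Scheme.{u}} [IsIntegral X] [IsNoetherian X] (hX : Scheme.IsRegular X)
    {I : X.IdealSheafData} (hI : I ≠ ⊥) (hIp : IsLocallyPrincipal I) :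
    I = monomialIdeal (((finite_divisorialPoints hI).toFinset.toList).map
      fun ζ => (primeDivisorIdeal ζ, (idealOrder I ζ).toNat)) := by
  classical
  have hJ : codimTwoPart I = ⊤ := (isLocallyPrincipal_iff_codimTwoPart_eq_top hX hI).mp hIp
  have hIH : I = divisorialPart I := by
    conv_lhs => rw [← divisorialPart_mul_codimTwoPart hX hI, hJ, Scheme.IdealSheafData.mul_top]
  calc I = divisorialPart I := hIH
    _ = ∏ ζ ∈ (finite_divisorialPoints hI).toFinset, primeDivisorIdeal ζ ^ (idealOrder I ζ).toNat :=
        divisorialPart_eq (finite_divisorialPoints hI)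
    _ = _ := by rw [monomialIdeal, List.map_map, Finset.prod_map_toList]; rfl

/-! ## The snc end-game -/

/-- **[OURS · W4.6 rung (ii-2), brick B7] SNC END-GAME, monomial form.** Let `X` be regular and locally Noetherian,
`I = monomialIdeal E` a monomial ideal (`Π_j K_j^{a_j}`), `m ≥ 1`, `U ⊆ X` an open subscheme and `Z ⊆ U` a closed set
containing every point `x` with `m ≤ ord_x I`. If the boundary list of `E` RESTRICTED TO `U` has simple normal crossings on
`U` (`HasSNC`), then `(X, I, m)` is order-reducible by permissible blowing-ups (`CampaignW46.OrderReducible` — replaces the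
role of the conclusion of the rung-(ii) statement read on one input; NOT a statement of the manuscript): on `U` by the
monomial slice `orderReducible_monomialIdeal` (res-L1-s46-pv-3, Kollár (3.111) Step 3), extended to `X` by
`OrderReducible.of_opens`. [cite: Kollar2007, (3.111) Step 3] [cite: Piltant2013, Prop. 5.1 (proof, Step 2)] -/
theorem orderReducible_monomialIdeal_of_hasSNC_nhds {X : Scheme.{u}} [IsLocallyNoetherian X] (hX : Scheme.IsRegular X)
    (E : List (X.IdealSheafData × ℕ)) {m : ℕ} (hm : 1 ≤ m) (U : X.Opens) (Z : Set X) (hZ : IsClosed Z)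
    (hIZ : ∀ x : X, (m : ℕ∞) ≤ idealOrder (monomialIdeal E) x → x ∈ Z) (hZU : Z ⊆ (U : Set X))
    (hsnc : HasSNC (boundaryOf (E.map fun p => (p.1.comap U.ι, p.2)))) :
    OrderReducible (monomialIdeal E) m := by
  haveI : IsLocallyNoetherian (U : Scheme.{u}) := LocallyOfFiniteType.isLocallyNoetherian U.ι
  refine OrderReducible.of_opens hX U (monomialIdeal E) Z hZ hIZ hZU ?_
  rw [comap_monomialIdeal_eq]
  exact orderReducible_monomialIdeal _ hsnc hm

/-- **[OURS · W4.6 rung (ii-2), brick B7] SNC END-GAME for a locally principal ideal on a regular integral Noetherian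
excellent scheme.** Let `I ≠ 0` be locally principal (e.g. effective Cartier), `m ≥ 1`, and `U ⊆ X` an open subscheme
containing every point `x` with `m ≤ ord_x I` (a closed set: upper semicontinuity of the order,
`isClosed_setOf_le_idealOrder`). If the prime divisors `𝓘_{cl ζ}` of `V(I)` (`ζ` its codimension-one points), restricted to
`U`, have simple normal crossings on `U`, then `(X, I, m)` is order-reducible — the END-GAME of the surface rung: once every
point of `Sing(I, m)` is a simple-normal-crossings point of `Supp I`, take `U := X ∖ NonSNC(Supp I)`. Dimension-free.
[cite: Kollar2007, (3.111) Step 3] [cite: CossartPiltant2008, proof of Prop. 4.2] -/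
theorem orderReducible_of_hasSNC_nhds {X : Scheme.{u}} [IsIntegral X] [IsNoetherian X] (hX : Scheme.IsRegular X)
    (hXe : Scheme.IsExcellent X) {I : X.IdealSheafData} (hI : I ≠ ⊥) (hIp : IsLocallyPrincipal I) {m : ℕ} (hm : 1 ≤ m)
    (U : X.Opens) (hU : ∀ x : X, (m : ℕ∞) ≤ idealOrder I x → x ∈ (U : Set X))
    (hsnc : HasSNC ((((finite_divisorialPoints hI).toFinset.toList).map fun ζ => (primeDivisorIdeal ζ).comap U.ι))) :
    OrderReducible I m := by
  classical
  set E : List (X.IdealSheafData × ℕ) :=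
    ((finite_divisorialPoints hI).toFinset.toList).map fun ζ => (primeDivisorIdeal ζ, (idealOrder I ζ).toNat) with hEdef
  have hIE : I = monomialIdeal E := eq_monomialIdeal_divisorial hX hI hIp
  have hb : boundaryOf (E.map fun p => (p.1.comap U.ι, p.2)) =
      ((finite_divisorialPoints hI).toFinset.toList).map fun ζ => (primeDivisorIdeal ζ).comap U.ι := by
    rw [boundaryOf_map_comap, hEdef, boundaryOf, List.map_map, List.map_map]
    rfl
  rw [hIE]
  refine orderReducible_monomialIdeal_of_hasSNC_nhds hX E hm U {x | (m : ℕ∞) ≤ idealOrder I x}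
    (isClosed_setOf_le_idealOrder hX hXe hI m) (fun x hx => by rwa [← hIE] at hx) hU ?_
  rw [hb]
  exact hsnc

/-- The same for an EFFECTIVE CARTIER ideal (the binder of the ladder `GammaFreeGlobalOrderReductionDimLE p d`).
[cite: Kollar2007, (3.111) Step 3] -/
theorem orderReducible_of_hasSNC_nhds_of_isEffectiveCartier {X : Scheme.{u}} [IsIntegral X] [IsNoetherian X]
    (hX : Scheme.IsRegular X) (hXe : Scheme.IsExcellent X) {I : X.IdealSheafData} (hI : I ≠ ⊥)
    (hIc : IsEffectiveCartier I) {m : ℕ} (hm : 1 ≤ m) (U : X.Opens)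
    (hU : ∀ x : X, (m : ℕ∞) ≤ idealOrder I x → x ∈ (U : Set X))
    (hsnc : HasSNC ((((finite_divisorialPoints hI).toFinset.toList).map fun ζ => (primeDivisorIdeal ζ).comap U.ι))) :
    OrderReducible I m :=
  orderReducible_of_hasSNC_nhds hX hXe hI hIc.isLocallyPrincipal hm U hU hsnc

end CampaignW46

end Summit.ResolutionOfSingularities.ResolutionOfSingularities.Theorems

end
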